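import Summits.CriticalPhenomena.PercolationContinuityZ3.Theorems.Transplant.FKConnectivityAllQAntipodalRootForm3BaseParLinks
import Summits.CriticalPhenomena.PercolationContinuityZ3.Theorems.Transplant.FKConnectivityAllQAntipodalRootForm3CertParAll
import HarnessLib

/-!
# Connectivity correlation inequalities for `φ_{w,q}` — ROOT-FORM CALCULUS, file 73c: bookkeeping and SATURATION for the GLUE(2,1)∥ certificate — the residual
# is admissible at EVERY threshold (`Base3.rho_all`)

Support file (`--supports stmt-CriticalPhenomena-4575`), FK sub-lane `prim-bschramm-fk-2` (gen 31); builds on p205010 (kernel theorem, internal audit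
signed; external expert review pending).  No definitions, no named facts, no sorries.  Memo FROM-fk-2-g31-DUALITY.md §6–§8 ((G3)).
* `rowE_eq/rowB_eq` (the table rows as list sums), `sum_list_map_comm`, `list_sum_nonneg`;
* SATURATION (61d pattern): offsets of consistent types (`pdL_bound`), `con_sat`, `exd_sat`, `mv1/mv0_sat`, `pv1/pv0_sat`, `evalE_sat`, `evalB_sat`,
  `rowE_sat/rowB_sat`, `lam_bound`, `X1_sat/X0_sat`: every term of the certificate vanishes for `k ≤ −5 ∨ 7 ≤ k`;
* **`rho_all`** — the residual of the certificate satisfies `ρ₁ ≥ 0 ∧ ρ₁ + ρ₀ ≥ 0` at EVERY threshold for consistent types (inside the window `Cert3.ks`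
  by `Cert3.rho_window` of file 72e, outside by saturation).  The regrouping into the abstract gluing theorem is file 73d.
[folklore]
-/

noncomputable section

namespace Summit.CriticalPhenomena.PercolationContinuityZ3.Theorems

namespace FK

namespace RootForm

namespace Base3

open Finset Base Gen Cert3

/-! ### List bookkeeping -/

/-- `rowE` as a pair of list sums. [folklore] -/
theorem rowE_eq (es : List (EF × ℤ × ℤ)) (τ : PT) (k : ℤ) :
    rowE es τ k = ((es.map fun e => e.2.2 * (evalE e.1 τ (k - e.2.1)).1).sum, (es.map fun e => e.2.2 * (evalE e.1 τ (k - e.2.1)).2).sum) := by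
  unfold rowE
  suffices h : ∀ acc : ℤ × ℤ, es.foldl (fun acc e => add2 acc (smul2 e.2.2 (evalE e.1 τ (k - e.2.1)))) acc =
      (acc.1 + (es.map fun e => e.2.2 * (evalE e.1 τ (k - e.2.1)).1).sum, acc.2 + (es.map fun e => e.2.2 * (evalE e.1 τ (k - e.2.1)).2).sum) by
    have := h (0, 0); simpa using this
  induction es with
  | nil => intro acc; simp
  | cons e es ih =>
    intro acc
    rw [List.foldl_cons, ih]
    simp only [add2, smul2, List.map_cons, List.sum_cons]
    refine Prod.ext ?_ ?_ <;> simp only <;> ring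
/-- `rowB` as a pair of list sums. [folklore] -/
theorem rowB_eq (bs : List (BF × ℤ × ℤ)) (t : Cert.BT) (k : ℤ) :
    rowB bs t k = ((bs.map fun e => e.2.2 * (evalB e.1 t (k - e.2.1)).1).sum, (bs.map fun e => e.2.2 * (evalB e.1 t (k - e.2.1)).2).sum) := by
  unfold rowB
  suffices h : ∀ acc : ℤ × ℤ, bs.foldl (fun acc e => add2 acc (smul2 e.2.2 (evalB e.1 t (k - e.2.1)))) acc =
      (acc.1 + (bs.map fun e => e.2.2 * (evalB e.1 t (k - e.2.1)).1).sum, acc.2 + (bs.map fun e => e.2.2 * (evalB e.1 t (k - e.2.1)).2).sum) by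
    have := h (0, 0); simpa using this
  induction bs with
  | nil => intro acc; simp
  | cons e es ih =>
    intro acc
    rw [List.foldl_cons, ih]
    simp only [add2, smul2, List.map_cons, List.sum_cons]
    refine Prod.ext ?_ ?_ <;> simp only <;> ring

/-- exchanging a finite sum with a list sum. [folklore] -/
theorem sum_list_map_comm {X C : Type*} [Fintype C] (l : List X) (g : X → C → ℝ) :
    ∑ c, (l.map fun x => g x c).sum = (l.map fun x => ∑ c, g x c).sum := by
  induction l with
  | nil => simp
  | cons x l ih => simp only [List.map_cons, List.sum_cons, Finset.sum_add_distrib, ih]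

/-- a list sum of nonnegative reals is nonnegative. [folklore] -/
theorem list_sum_nonneg {X : Type*} (l : List X) (f : X → ℝ) (h : ∀ x ∈ l, 0 ≤ f x) : 0 ≤ (l.map f).sum := by
  induction l with
  | nil => simp
  | cons x l ih =>
    rw [List.map_cons, List.sum_cons]
    exact add_nonneg (h x (List.mem_cons_self)) (ih fun y hy => h y (List.mem_cons_of_mem _ hy))

/-! ### Saturation: every term of the certificate vanishes far from the window -/

section Sat

/-- offsets of a locally consistent two-special type lie in `[−2, 2]` (and `ΔΛ_y, ΔΛ_z ∈ [−1,1]`, `ΔΛ_∅ = 0`). [folklore] -/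
theorem pdL_bound (τ : PT) (h : consistentP τ = true) (Q : Fin 4) : -2 ≤ τ.dL Q ∧ τ.dL Q ≤ 2 := by
  have h' := h
  simp only [consistentP, Bool.and_eq_true] at h'
  obtain ⟨⟨⟨h01, h02⟩, h13⟩, _⟩ := h'
  have b01 := stepOK_bound τ 0 1 h01
  have b02 := stepOK_bound τ 0 2 h02
  have b13 := stepOK_bound τ 1 3 h13
  have h0 : τ.dL 0 = 0 := rfl
  have h3 : τ.dL 3 = (τ.dL 3 - τ.dL 1) + τ.dL 1 := by ring
  have hQ : Q = 0 ∨ Q = 1 ∨ Q = 2 ∨ Q = 3 := by fin_cases Q <;> simp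
  rcases hQ with rfl | rfl | rfl | rfl <;> omega

/-- the middle offsets lie in `[−1, 1]`. [folklore] -/
theorem pdL_bound_mid (τ : PT) (h : consistentP τ = true) : -1 ≤ τ.dL 1 ∧ τ.dL 1 ≤ 1 ∧ -1 ≤ τ.dL 2 ∧ τ.dL 2 ≤ 1 ∧ τ.dL 0 = 0 := by
  have h' := h
  simp only [consistentP, Bool.and_eq_true] at h'
  obtain ⟨⟨⟨h01, h02⟩, _⟩, _⟩ := h'
  have b01 := stepOK_bound τ 0 1 h01
  have b02 := stepOK_bound τ 0 2 h02
  have h0 : τ.dL 0 = 0 := rfl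
  rw [h0] at b01 b02
  omega

variable (τ : PT) (hτ : consistentP τ = true)
include hτ

/-- `con` saturates. [folklore] -/
theorem con_sat (Q : Fin 4) (kp : ℤ) : (kp ≤ -3 → con τ Q kp = 0) ∧ (4 ≤ kp → con τ Q kp = 1) := by
  have hd := pdL_bound τ hτ Q; have h1 := Cert.bi_bound (τ.K1 Q); have h2 := Cert.bi_bound (τ.K2 Q)
  unfold con
  exact ⟨fun hk => Cert.I_le_false (by omega), fun hk => Cert.I_le_true (by omega)⟩
/-- `exd` vanishes far out. [folklore] -/
theorem exd_sat (Q : Fin 4) (kp : ℤ) (hk : kp ≤ -3 ∨ 4 ≤ kp) : exd τ Q kp = 0 := by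
  have hd := pdL_bound τ hτ Q
  unfold exd; rw [Cert.I_eq_false (by omega)]; simp
/-- `mv1` vanishes far out. [folklore] -/
theorem mv1_sat (kp : ℤ) (hk : kp ≤ -3 ∨ 4 ≤ kp) : mv1 τ kp = 0 := by
  obtain ⟨h1a, h1b, h2a, h2b, h0⟩ := pdL_bound_mid τ hτ
  have h3 := pdL_bound τ hτ 3
  have b0 := Cert.bi_bound (τ.K1 0); have b3 := Cert.bi_bound (τ.K1 3)
  unfold mv1; rw [h0]
  rcases hk with hk | hk
  · rw [Cert.I_le_false (by omega), Cert.I_le_false (by omega), Cert.I_eq_false (by omega), Cert.I_eq_false (by omega)]; simp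
  · rw [Cert.I_le_true (by omega), Cert.I_le_true (by omega), Cert.I_eq_false (by omega), Cert.I_eq_false (by omega)]; simp
/-- `mv0` vanishes far out. [folklore] -/
theorem mv0_sat (kp : ℤ) (hk : kp ≤ -3 ∨ 4 ≤ kp) : mv0 τ kp = 0 := by
  obtain ⟨h1a, h1b, h2a, h2b, h0⟩ := pdL_bound_mid τ hτ
  have h3 := pdL_bound τ hτ 3
  have b0 := Cert.bi_bound (τ.K2 0); have b3 := Cert.bi_bound (τ.K2 3)
  unfold mv0; rw [h0]
  rcases hk with hk | hk
  · rw [Cert.I_le_false (by omega), Cert.I_le_false (by omega), Cert.I_eq_false (by omega), Cert.I_eq_false (by omega)]; simp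
  · rw [Cert.I_le_true (by omega), Cert.I_le_true (by omega), Cert.I_eq_false (by omega), Cert.I_eq_false (by omega)]; simp
/-- `pv1` vanishes far out. [folklore] -/
theorem pv1_sat (b : Bool) (kp : ℤ) (hk : kp ≤ -3 ∨ 4 ≤ kp) : pv1 τ b kp = 0 := by
  obtain ⟨h1a, h1b, h2a, h2b, h0⟩ := pdL_bound_mid τ hτ
  have h3 := pdL_bound τ hτ 3
  have c0 := Cert.bi_bound (if b then τ.K1 0 else τ.K2 0); have c3 := Cert.bi_bound (if b then τ.K1 3 else τ.K2 3)
  have c1 := Cert.bi_bound (if b then τ.K1 1 else τ.K2 1); have c2 := Cert.bi_bound (if b then τ.K1 2 else τ.K2 2)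
  have e0 := Cert.bi_bound (b || τ.K1 0); have e3 := Cert.bi_bound (b || τ.K1 3)
  unfold pv1; rw [h0]
  rcases hk with hk | hk
  · rw [Cert.I_le_false (by omega), Cert.I_le_false (by omega), Cert.I_eq_false (by omega), Cert.I_eq_false (by omega)]; simp
  · rw [Cert.I_le_true (by omega), Cert.I_le_true (by omega), Cert.I_eq_false (by omega), Cert.I_eq_false (by omega)]; simp
/-- `pv0` vanishes far out. [folklore] -/
theorem pv0_sat (b : Bool) (kp : ℤ) (hk : kp ≤ -3 ∨ 4 ≤ kp) : pv0 τ b kp = 0 := by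
  obtain ⟨h1a, h1b, h2a, h2b, h0⟩ := pdL_bound_mid τ hτ
  have h3 := pdL_bound τ hτ 3
  have c0 := Cert.bi_bound (if b then τ.K1 0 else τ.K2 0); have c3 := Cert.bi_bound (if b then τ.K1 3 else τ.K2 3)
  have c1 := Cert.bi_bound (if b then τ.K1 1 else τ.K2 1); have c2 := Cert.bi_bound (if b then τ.K1 2 else τ.K2 2)
  have e0 := Cert.bi_bound (!b || τ.K2 0); have e3 := Cert.bi_bound (!b || τ.K2 3)
  unfold pv0; rw [h0]
  rcases hk with hk | hk
  · rw [Cert.I_le_false (by omega), Cert.I_le_false (by omega), Cert.I_eq_false (by omega), Cert.I_eq_false (by omega)]; simp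
  · rw [Cert.I_le_true (by omega), Cert.I_le_true (by omega), Cert.I_eq_false (by omega), Cert.I_eq_false (by omega)]; simp

/-- every E₁-side generator vanishes far out. [folklore] -/
theorem evalE_sat (f : EF) (kp : ℤ) (hk : kp ≤ -3 ∨ 4 ≤ kp) : evalE f τ kp = (0, 0) := by
  have hc : ∀ Q Q', con τ Q kp - con τ Q' kp = 0 := by
    intro Q Q'
    rcases hk with hk | hk
    · rw [(con_sat τ hτ Q kp).1 hk, (con_sat τ hτ Q' kp).1 hk]; simp
    · rw [(con_sat τ hτ Q kp).2 hk, (con_sat τ hτ Q' kp).2 hk]; simp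
  cases f <;> simp only [evalE, add2, put, mv1_sat τ hτ kp hk, mv0_sat τ hτ kp hk, pv1_sat τ hτ _ kp hk, pv0_sat τ hτ _ kp hk,
    exd_sat τ hτ _ kp hk, hc, add_zero] <;> split_ifs <;> simp

end Sat

/-- every box-side generator vanishes far out. [folklore] -/
theorem evalB_sat (t : Cert.BT) (ht : Cert.consistentB t = true) (f : BF) (K : ℤ) (hK : K ≤ -3 ∨ 3 ≤ K) : evalB f t K = (0, 0) := by
  have hd := Cert.dL_bound t ht
  cases f <;> simp only [evalB, add2, put, Cert.A1_sat t hd K hK, Cert.A3u_sat t hd K hK, Cert.A3l_sat t hd K hK,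
    Cert.A4u_sat t hd K hK, Cert.A4l_sat t K hK]
    <;> split_ifs <;> simp

/-- the row contributions vanish far from the window. [folklore] -/
theorem rowE_sat (τ : PT) (hτ : consistentP τ = true) (es : List (EF × ℤ × ℤ)) (hes : ∀ e ∈ es, okE e = true) (k : ℤ) (hk : k ≤ -5 ∨ 7 ≤ k) :
    rowE es τ k = (0, 0) := by
  rw [rowE_eq]
  have hz : ∀ e ∈ es, evalE e.1 τ (k - e.2.1) = (0, 0) := by
    intro e he
    have ho := hes e he
    simp only [okE, Bool.and_eq_true, decide_eq_true_eq] at ho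
    exact evalE_sat τ hτ e.1 _ (by omega)
  refine Prod.ext ?_ ?_
  · show (es.map fun e => e.2.2 * (evalE e.1 τ (k - e.2.1)).1).sum = 0
    rw [List.map_congr_left (fun e he => by rw [hz e he]), ]; simp
  · show (es.map fun e => e.2.2 * (evalE e.1 τ (k - e.2.1)).2).sum = 0
    rw [List.map_congr_left (fun e he => by rw [hz e he])]; simp
/-- see `rowE_sat`. [folklore] -/
theorem rowB_sat (t : Cert.BT) (ht : Cert.consistentB t = true) (bs : List (BF × ℤ × ℤ)) (hbs : ∀ e ∈ bs, okB e = true) (k : ℤ) (hk : k ≤ -5 ∨ 7 ≤ k) :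
    rowB bs t k = (0, 0) := by
  rw [rowB_eq]
  have hz : ∀ e ∈ bs, evalB e.1 t (k - e.2.1) = (0, 0) := by
    intro e he
    have ho := hbs e he
    simp only [okB, Bool.and_eq_true, decide_eq_true_eq] at ho
    exact evalB_sat t ht e.1 _ (by omega)
  refine Prod.ext ?_ ?_
  · show (bs.map fun e => e.2.2 * (evalB e.1 t (k - e.2.1)).1).sum = 0
    rw [List.map_congr_left (fun e he => by rw [hz e he])]; simp
  · show (bs.map fun e => e.2.2 * (evalB e.1 t (k - e.2.1)).2).sum = 0
    rw [List.map_congr_left (fun e he => by rw [hz e he])]; simp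

/-- the composite level and bits are bounded. [folklore] -/
theorem lam_bound (τ : PT) (hτ : consistentP τ = true) (t : Cert.BT) (ht : Cert.consistentB t = true) (Q : Fin 4) (s : Bool) :
    -3 ≤ lam τ t Q s ∧ lam τ t Q s ≤ 5 := by
  have hd := pdL_bound τ hτ Q; have hb := Cert.dL_bound t ht
  have b1 := Cert.bi_bound (τ.K1 Q && Cert.ccB t s); have b2 := Cert.bi_bound (τ.K2 Q && Cert.cbB t s)
  unfold lam Cert.lev; cases s <;> simp only [if_true, if_false, Bool.false_eq_true] at * <;> omega
/-- the target vanishes far out, slot 1. [folklore] -/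
theorem X1_sat (τ : PT) (hτ : consistentP τ = true) (t : Cert.BT) (ht : Cert.consistentB t = true) (k : ℤ) (hk : k ≤ -5 ∨ 7 ≤ k) : X1 τ t k = 0 := by
  have l0 := lam_bound τ hτ t ht 0 false; have l3 := lam_bound τ hτ t ht 3 true
  have c0 := Cert.bi_bound (Cert3.C1 τ t 0 false); have c3 := Cert.bi_bound (Cert3.C1 τ t 3 true)
  have hm : (mixed3.map fun q => Cert.bi (Cert3.C1 τ t q.1 q.2) * Cert.I (lam τ t q.1 q.2 = k)).sum = 0 := by
    have : ∀ q ∈ mixed3, Cert.bi (Cert3.C1 τ t q.1 q.2) * Cert.I (lam τ t q.1 q.2 = k) = 0 := by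
      intro q _; have lq := lam_bound τ hτ t ht q.1 q.2; rw [Cert.I_eq_false (by omega)]; simp
    rw [List.map_congr_left this]; simp [mixed3]
  unfold X1; rw [hm]
  rcases hk with hk | hk
  · rw [Cert.I_le_false (by omega), Cert.I_le_false (by omega)]; simp
  · rw [Cert.I_le_true (by omega), Cert.I_le_true (by omega)]; simp
/-- the target vanishes far out, slot 0. [folklore] -/
theorem X0_sat (τ : PT) (hτ : consistentP τ = true) (t : Cert.BT) (ht : Cert.consistentB t = true) (k : ℤ) (hk : k ≤ -5 ∨ 7 ≤ k) : X0 τ t k = 0 := by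
  have l0 := lam_bound τ hτ t ht 0 false; have l3 := lam_bound τ hτ t ht 3 true
  have c0 := Cert.bi_bound (Cert3.C2 τ t 0 false); have c3 := Cert.bi_bound (Cert3.C2 τ t 3 true)
  have hm : (mixed3.map fun q => Cert.bi (Cert3.C2 τ t q.1 q.2) * Cert.I (lam τ t q.1 q.2 = k)).sum = 0 := by
    have : ∀ q ∈ mixed3, Cert.bi (Cert3.C2 τ t q.1 q.2) * Cert.I (lam τ t q.1 q.2 = k) = 0 := by
      intro q _; have lq := lam_bound τ hτ t ht q.1 q.2; rw [Cert.I_eq_false (by omega)]; simp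
    rw [List.map_congr_left this]; simp [mixed3]
  unfold X0; rw [hm]
  rcases hk with hk | hk
  · rw [Cert.I_le_false (by omega), Cert.I_le_false (by omega)]; simp
  · rw [Cert.I_le_true (by omega), Cert.I_le_true (by omega)]; simp

/-- **The certificate residual is admissible at EVERY threshold** (window: `rho_window`; outside: everything vanishes). [folklore] -/
theorem rho_all (τ : PT) (hτ : consistentP τ = true) (t : Cert.BT) (ht : Cert.consistentB t = true) (k : ℤ) :
    0 ≤ (rho τ (lookupB τ) t (lookupE t) k).1 ∧ 0 ≤ (rho τ (lookupB τ) t (lookupE t) k).1 + (rho τ (lookupB τ) t (lookupE t) k).2 := by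
  by_cases hk : -4 ≤ k ∧ k ≤ 6
  · have hmem : k ∈ ks := by
      obtain ⟨h1, h2⟩ := hk
      unfold ks
      interval_cases k <;> simp
    exact rho_window τ hτ t ht k hmem
  · have hk' : k ≤ -5 ∨ 7 ≤ k := by omega
    simp only [rho, X1_sat τ hτ t ht k hk', X0_sat τ hτ t ht k hk', rowE_sat τ hτ _ (lookupE_ok t ht) k hk', rowB_sat t ht _ (lookupB_ok τ hτ) k hk']
    norm_num

end Base3

end RootForm

end FK

end Summit.CriticalPhenomena.PercolationContinuityZ3.Theorems

end
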